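import Literature.AlgebraicGeometry.Frobenioids.PerfectionEndomorphisms
import Literature.AlgebraicGeometry.Frobenioids.PerfectionLifting
import HarnessLib

/-!
# Frobenioids I, Proposition 3.2 (iii) "`C^pf` is a Frobenioid": Definition 1.3 (iii) (a), (b), (c) for
# the perfection — co-angular morphisms and the transport of `O^▷` along co-angular pre-steps (PROOFS)

Mochizuki, *The geometry of Frobenioids I: the general theory*, Kyushu J. Math. **62** (2008)
293–400, Definition 1.3 (iii) p. 24, Definition 3.1 (iii) p. 57, Proposition 3.2 (iii) p. 59
[cite: MochizukiFrdI2008, Prop. 3.2 (iii) p.59]: "`C^pf`, equipped with the functor `C^pf → F_{Φ^pf}` …, is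
a Frobenioid of perfect and isotropic type", printed proof p. 59: "follow[s] immediately from the
definitions; Proposition 1.10, (i)".

PROOF-ONLY piece of the row «`C^pf` is a Frobenioid» (abc-iut cell, row `FrdI:Prop3.2(iii)-frobenioid`,
carve-up of seats abc-iut-L1-d1 / abc-iut-L1-d9, 2026-08-25; this piece: the Def. 1.3 (iii) clauses, seat
abc-iut-w5-d246), stated DATA-LEVEL over abc-iut-L1-d9's operations `Perfection.ops hF` of `C^pf`, under
print's standing hypothesis of §3 that `C` is of Frobenius-isotropic type (`hiso`):

* (iii)(a), (iii)(b) — `isCoAngular_of_frobeniusIsotropic`: EVERY arrow of `C^pf` is co-angular, since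
  `C^pf` is of isotropic type (`isOfIsotropicType_perfection`, abc-iut-L1-d9), so the isometric pre-step
  in any factorization is an isomorphism; `iii_a_perfection`, `iii_b_perfection`;
* (iii)(c) — `iii_c_perfection`: a co-angular pre-step `φ : (A, n) → (B, m)` of `C^pf` induces a
  multiplicative bijection `O^▷((A, n)) ⥲ O^▷((B, m))`, `α ↦ β` with `φ ≫ β = α ≫ φ`.  Printed argument
  made explicit: `O^▷((A, n)) = lim_c O^▷(A^{(c)})` (abc-iut-L1-d9, `PerfectionEndomorphisms.lean`); a
  representative `ρ : A^{(a)} → B^{(b)}` of `φ` and a representative `θ ∈ O^▷(A^{(c)})` of `α` are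
  transported to a common level `(a·t, b·t)`, `t = c · deg_Fr(A → A′)` for a Frobenius-type arrow to an
  isotropic `A′` (Frobenius-isotropic type), where the transported `ρ` is a pre-step of `C` with
  ISOTROPIC domain (Def. 1.3 (ii), (vii)(b): `isIsotropic_frobPow`), hence a co-angular pre-step of `C`
  (Prop. 1.4 (i)); Def. 1.3 (iii)(c) of `C` then provides the intertwiner, and the classes intertwine in
  `C^pf`.  The bijection is assembled from these intertwiners by the cancellation laws of `C^pf`
  (every arrow is an epimorphism, `epi_hom`, abc-iut-L1-d1; pre-steps are monomorphisms,
  `mono_of_isPreStep`, abc-iut-L1-d9) — the same way Prop. 3.3 (iv) was done for `C^un-tr`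
  (`UnitTrivializationIsFrobenioid.lean`, abc-iut-L1-d5).
The clause "(iii)(c) depends only on `Base(φ)`" and the four clauses of (iii)(d) are the sequel files.
No new definitions; nothing here is specific to the abc programme.
-/

namespace Literature.AlgebraicGeometry.Frobenioids

namespace PreFrobenioid

namespace Perfection

open CategoryTheory Opposite

universe w v v' u u'

variable {D : Type u} [Category.{v} D] {Φ : Dᵒᵖ ⥤ CommMonCat.{w}}
  {C : Type u'} [Category.{v'} C] {F : C ⥤ ElemFrobenioid Φ} {hF : IsFrobenioid F}

/-! ### Definition 1.3 (iii)(a), (b): every arrow of `C^pf` is co-angular -/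

/-- For `C` of Frobenius-isotropic type EVERY arrow of `C^pf` is co-angular: `C^pf` is of isotropic type
(Prop. 3.2 (iii)), so the isometric pre-step of any factorization is an isomorphism.
[cite: MochizukiFrdI2008, Prop. 3.2 (iii) p.59] -/
theorem isCoAngular_of_frobeniusIsotropic (hiso : IsOfType (IsFrobeniusIsotropic F))
    {X Y : Perfection hF} (f : X ⟶ Y) : (ops hF).IsCoAngular f :=
  fun X' _ _ β _ _ _ hβ _ => (isOfIsotropicType_perfection hF hiso).obj X' β hβ

/-- **Def. 1.3 (iii)(a) for `C^pf`**: co-angular arrows of `C^pf` are closed under composition.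
[cite: MochizukiFrdI2008, Prop. 3.2 (iii) p.59] -/
theorem iii_a_perfection (hiso : IsOfType (IsFrobeniusIsotropic F)) ⦃X Y Z : Perfection hF⦄ (f : X ⟶ Y)
    (g : Y ⟶ Z) (_ : (ops hF).IsCoAngular f) (_ : (ops hF).IsCoAngular g) : (ops hF).IsCoAngular (f ≫ g) :=
  isCoAngular_of_frobeniusIsotropic hiso _

/-- **Def. 1.3 (iii)(b) for `C^pf`**: if some `X' → X` is a co-angular pre-step then every `X' → X` is
co-angular. [cite: MochizukiFrdI2008, Prop. 3.2 (iii) p.59] -/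
theorem iii_b_perfection (hiso : IsOfType (IsFrobeniusIsotropic F)) ⦃X' X : Perfection hF⦄ (φ : X' ⟶ X)
    (_ : (ops hF).IsCoAngularPreStep φ) (ψ : X' ⟶ X) : (ops hF).IsCoAngular ψ :=
  isCoAngular_of_frobeniusIsotropic hiso ψ

/-! ### Composites with endomorphism classes at an aligned level -/

/-- `[θ] ≫ [ρ] = [θ ≫ ρ]` for an endomorphism `θ` of `A^{(a)}` and a representative `ρ : A^{(a)} → B^{(b)}`
at the level `(a, b)`. [cite: MochizukiFrdI2008, Def. 3.1 (iii) p.57] -/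
theorem endClass_comp_mk {X Y : Perfection hF} (a b : ℕ+) (hab : X.idx * a = Y.idx * b)
    (θ : frobPow hF X.obj a ⟶ frobPow hF X.obj a) (ρ : frobPow hF X.obj a ⟶ frobPow hF Y.obj b) :
    endClass X a θ ≫ Hom.mk (⟨⟨a, b, hab⟩, ρ⟩ : Rep X Y) = Hom.mk ⟨⟨a, b, hab⟩, θ ≫ ρ⟩ := by
  have e := mk_compAt (⟨a, a, b, rfl, hab⟩ : Level₃ X X Y) ⟨Level.diag X a, θ⟩ ⟨⟨a, b, hab⟩, ρ⟩
    (Level.le_rfl _) (Level.le_rfl _)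
  rw [endClass_def, mk_comp_mk, ← e]
  unfold compAt
  rw [Level.lift_rfl, Level.lift_rfl]

/-- `[ρ] ≫ [η] = [ρ ≫ η]` for a representative `ρ : A^{(a)} → B^{(b)}` at the level `(a, b)` and an
endomorphism `η` of `B^{(b)}`. [cite: MochizukiFrdI2008, Def. 3.1 (iii) p.57] -/
theorem mk_comp_endClass {X Y : Perfection hF} (a b : ℕ+) (hab : X.idx * a = Y.idx * b)
    (ρ : frobPow hF X.obj a ⟶ frobPow hF Y.obj b) (η : frobPow hF Y.obj b ⟶ frobPow hF Y.obj b) :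
    Hom.mk (⟨⟨a, b, hab⟩, ρ⟩ : Rep X Y) ≫ endClass Y b η = Hom.mk ⟨⟨a, b, hab⟩, ρ ≫ η⟩ := by
  have e := mk_compAt (⟨a, b, b, hab, rfl⟩ : Level₃ X Y Y) ⟨⟨a, b, hab⟩, ρ⟩ ⟨Level.diag Y b, η⟩
    (Level.le_rfl _) (Level.le_rfl _)
  rw [endClass_def, mk_comp_mk, ← e]
  unfold compAt
  rw [Level.lift_rfl, Level.lift_rfl]

/-! ### Transported representatives with isotropic domain are co-angular pre-steps of `C` -/

/-- A pre-step of `C` out of a chosen Frobenius power `A^{(a)}`, `deg_Fr(A → A′) ∣ a` for a Frobenius-type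
arrow to an isotropic `A′`, is a co-angular pre-step of `C` (its domain is isotropic, Def. 1.3 (vii)(b);
Prop. 1.4 (i)). [cite: MochizukiFrdI2008, Prop. 1.4 (i) p.25] -/
theorem isCoAngularPreStep_of_isPreStep_frobPow {A A' B' : C} {φ₀ : A ⟶ A'} (hφ₀ : IsFrobeniusType F φ₀)
    (hA' : IsIsotropic F A') {a : ℕ+} (hd : PreFrobenioid.degFr F φ₀ ∣ a) {ρ : frobPow hF A a ⟶ B'}
    (hρ : IsPreStep F ρ) : IsCoAngularPreStep F ρ :=
  ⟨isCoAngular_of_isIsotropic_codomains F ρ fun _ g => hF.vii_b g (isIsotropic_frobPow hF hφ₀ hA' hd), hρ⟩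

/-! ### Definition 1.3 (iii)(c): pushing `O^▷` across a pre-step -/

/-- Pushing `u ∈ O^▷((A, n))` across a pre-step representative `ρ : A^{(a)} → B^{(b)}`: there is
`w ∈ O^▷((B, m))` with `[ρ] ≫ w = u ≫ [ρ]` (via Def. 1.3 (iii)(c) of `C` at an aligned isotropic level).
[cite: MochizukiFrdI2008, Def. 1.3 (iii) p.24] -/
theorem exists_intertwiner (hiso : IsOfType (IsFrobeniusIsotropic F)) {X Y : Perfection hF}
    (a b : ℕ+) (hab : X.idx * a = Y.idx * b) (ρ : frobPow hF X.obj a ⟶ frobPow hF Y.obj b)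
    (hρ : IsPreStep F ρ) (u : (ops hF).endSubmonoid X) :
    ∃ w : (ops hF).endSubmonoid Y,
      Hom.mk (⟨⟨a, b, hab⟩, ρ⟩ : Rep X Y) ≫ (show Y ⟶ Y from w.1) =
        (show X ⟶ X from u.1) ≫ Hom.mk (⟨⟨a, b, hab⟩, ρ⟩ : Rep X Y) := by
  obtain ⟨c, θ, rfl⟩ := exists_endSubmonoidClassHom_eq X u
  obtain ⟨A', φ₀, hφ₀, hA'⟩ := hiso X.obj
  -- the aligned level `(a·t, b·t)`, `t = c · deg_Fr φ₀`
  have hc : c ∣ a * (c * PreFrobenioid.degFr F φ₀) := Dvd.intro _ (mul_left_comm _ _ _)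
  have hd : PreFrobenioid.degFr F φ₀ ∣ a * (c * PreFrobenioid.degFr F φ₀) :=
    Dvd.intro_left (a * c) (mul_assoc _ _ _)
  generalize c * PreFrobenioid.degFr F φ₀ = t at hc hd
  have hab' : X.idx * (a * t) = Y.idx * (b * t) := by rw [← mul_assoc, hab, mul_assoc]
  have hle : Level.LE (⟨a, b, hab⟩ : Level X Y) ⟨a * t, b * t, hab'⟩ := ⟨dvd_mul_right _ _, dvd_mul_right _ _⟩
  -- the transported representative is a co-angular pre-step of `C`
  have hR : IsCoAngularPreStep F (Level.lift (⟨a, b, hab⟩ : Level X Y) ⟨a * t, b * t, hab'⟩ hle ρ) :=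
    isCoAngularPreStep_of_isPreStep_frobPow hφ₀ hA' hd
      ((isPreStep_lift_iff (⟨⟨a, b, hab⟩, ρ⟩ : Rep X Y) _ hle).mpr hρ)
  obtain ⟨e₀, he₀⟩ := hF.iii_c _ hR
  -- the transported `θ`
  let Θ : endSubmonoid F (frobPow hF X.obj (a * t)) :=
    ⟨End.of (liftLevel hF (End.asHom θ.1) hc hc rfl), (liftLevel_mem_iff X hc θ.1 rfl).mpr θ.2⟩
  have hΘ : endSubmonoidClassHom X (a * t) Θ = endSubmonoidClassHom X c θ :=
    endSubmonoidClassHom_liftLevel X hc θ rfl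
  refine ⟨endSubmonoidClassHom Y (b * t) (e₀ Θ), ?_⟩
  rw [← hΘ, ← Hom.mk_lift (⟨⟨a, b, hab⟩, ρ⟩ : Rep X Y) ⟨a * t, b * t, hab'⟩ hle]
  change Hom.mk (⟨⟨a * t, b * t, hab'⟩, _⟩ : Rep X Y) ≫ endClass Y (b * t) (End.asHom (e₀ Θ).1) =
    endClass X (a * t) (End.asHom Θ.1) ≫ Hom.mk (⟨⟨a * t, b * t, hab'⟩, _⟩ : Rep X Y)
  rw [mk_comp_endClass, endClass_comp_mk]
  exact congrArg (fun f => Hom.mk (⟨⟨a * t, b * t, hab'⟩, f⟩ : Rep X Y)) (he₀ Θ)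

/-- Pulling `w ∈ O^▷((B, m))` back across a pre-step representative `ρ : A^{(a)} → B^{(b)}`: there is
`u ∈ O^▷((A, n))` with `[ρ] ≫ w = u ≫ [ρ]` (the inverse bijection of Def. 1.3 (iii)(c) of `C` at an aligned
isotropic level). [cite: MochizukiFrdI2008, Def. 1.3 (iii) p.24] -/
theorem exists_intertwiner_inv (hiso : IsOfType (IsFrobeniusIsotropic F)) {X Y : Perfection hF}
    (a b : ℕ+) (hab : X.idx * a = Y.idx * b) (ρ : frobPow hF X.obj a ⟶ frobPow hF Y.obj b)
    (hρ : IsPreStep F ρ) (w : (ops hF).endSubmonoid Y) :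
    ∃ u : (ops hF).endSubmonoid X,
      Hom.mk (⟨⟨a, b, hab⟩, ρ⟩ : Rep X Y) ≫ (show Y ⟶ Y from w.1) =
        (show X ⟶ X from u.1) ≫ Hom.mk (⟨⟨a, b, hab⟩, ρ⟩ : Rep X Y) := by
  obtain ⟨c, η, rfl⟩ := exists_endSubmonoidClassHom_eq Y w
  obtain ⟨A', φ₀, hφ₀, hA'⟩ := hiso X.obj
  -- the aligned level `(a·t, b·t)`, `t = c · deg_Fr φ₀`
  have hc : c ∣ b * (c * PreFrobenioid.degFr F φ₀) := Dvd.intro _ (mul_left_comm _ _ _)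
  have hd : PreFrobenioid.degFr F φ₀ ∣ a * (c * PreFrobenioid.degFr F φ₀) :=
    Dvd.intro_left (a * c) (mul_assoc _ _ _)
  generalize c * PreFrobenioid.degFr F φ₀ = t at hc hd
  have hab' : X.idx * (a * t) = Y.idx * (b * t) := by rw [← mul_assoc, hab, mul_assoc]
  have hle : Level.LE (⟨a, b, hab⟩ : Level X Y) ⟨a * t, b * t, hab'⟩ := ⟨dvd_mul_right _ _, dvd_mul_right _ _⟩
  have hR : IsCoAngularPreStep F (Level.lift (⟨a, b, hab⟩ : Level X Y) ⟨a * t, b * t, hab'⟩ hle ρ) :=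
    isCoAngularPreStep_of_isPreStep_frobPow hφ₀ hA' hd
      ((isPreStep_lift_iff (⟨⟨a, b, hab⟩, ρ⟩ : Rep X Y) _ hle).mpr hρ)
  obtain ⟨e₀, he₀⟩ := hF.iii_c _ hR
  -- the transported `η`
  let H : endSubmonoid F (frobPow hF Y.obj (b * t)) :=
    ⟨End.of (liftLevel hF (End.asHom η.1) hc hc rfl), (liftLevel_mem_iff Y hc η.1 rfl).mpr η.2⟩
  have hH : endSubmonoidClassHom Y (b * t) H = endSubmonoidClassHom Y c η :=
    endSubmonoidClassHom_liftLevel Y hc η rfl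
  refine ⟨endSubmonoidClassHom X (a * t) (e₀.symm H), ?_⟩
  rw [← hH, ← Hom.mk_lift (⟨⟨a, b, hab⟩, ρ⟩ : Rep X Y) ⟨a * t, b * t, hab'⟩ hle]
  change Hom.mk (⟨⟨a * t, b * t, hab'⟩, _⟩ : Rep X Y) ≫ endClass Y (b * t) (End.asHom H.1) =
    endClass X (a * t) (End.asHom (e₀.symm H).1) ≫ Hom.mk (⟨⟨a * t, b * t, hab'⟩, _⟩ : Rep X Y)
  rw [mk_comp_endClass, endClass_comp_mk]
  have key := he₀ (e₀.symm H)
  rw [MulEquiv.apply_symm_apply] at key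
  exact congrArg (fun f => Hom.mk (⟨⟨a * t, b * t, hab'⟩, f⟩ : Rep X Y)) key

/-- **Def. 1.3 (iii)(c) for `C^pf`** (for `C` of Frobenius-isotropic type): a co-angular pre-step
`φ : X → Y` of `C^pf` induces a bijection of monoids `O^▷(X) ⥲ O^▷(Y)`, `α ↦ β`, with `φ ≫ β = α ≫ φ`.
[cite: MochizukiFrdI2008, Prop. 3.2 (iii) p.59] -/
theorem iii_c_perfection (hiso : IsOfType (IsFrobeniusIsotropic F)) ⦃X Y : Perfection hF⦄ (φ : X ⟶ Y)
    (hφ : (ops hF).IsCoAngularPreStep φ) :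
    ∃ e : (ops hF).endSubmonoid X ≃* (ops hF).endSubmonoid Y,
      ∀ α : (ops hF).endSubmonoid X, φ ≫ (show Y ⟶ Y from (e α).1) = (show X ⟶ X from α.1) ≫ φ := by
  obtain ⟨⟨⟨a, b, hab⟩, ρ⟩, rfl⟩ := Hom.mk_surjective φ
  have hρ : IsPreStep F ρ := (isPreStep_mk_iff (⟨⟨a, b, hab⟩, ρ⟩ : Rep X Y)).mp hφ.2
  haveI := epi_hom (Hom.mk (⟨⟨a, b, hab⟩, ρ⟩ : Rep X Y) : X ⟶ Y)
  haveI := mono_of_isPreStep hφ.2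
  have hex := fun u => exists_intertwiner hiso a b hab ρ hρ u
  have hex' := fun w => exists_intertwiner_inv hiso a b hab ρ hρ w
  -- uniqueness of the intertwiner (every arrow of `C^pf` is an epimorphism)
  have huniq : ∀ (u : (ops hF).endSubmonoid X) (w w' : (ops hF).endSubmonoid Y),
      Hom.mk (⟨⟨a, b, hab⟩, ρ⟩ : Rep X Y) ≫ (show Y ⟶ Y from w.1) =
          (show X ⟶ X from u.1) ≫ Hom.mk (⟨⟨a, b, hab⟩, ρ⟩ : Rep X Y) →
        Hom.mk (⟨⟨a, b, hab⟩, ρ⟩ : Rep X Y) ≫ (show Y ⟶ Y from w'.1) =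
          (show X ⟶ X from u.1) ≫ Hom.mk (⟨⟨a, b, hab⟩, ρ⟩ : Rep X Y) → w = w' := by
    intro u w w' h h'
    apply Subtype.ext
    exact (cancel_epi (Hom.mk (⟨⟨a, b, hab⟩, ρ⟩ : Rep X Y) : X ⟶ Y)).mp (h.trans h'.symm)
  let g : (ops hF).endSubmonoid X →* (ops hF).endSubmonoid Y :=
    { toFun := fun u => Classical.choose (hex u)
      map_one' := by
        apply huniq 1 _ 1 (Classical.choose_spec (hex 1))
        change _ ≫ 𝟙 Y = 𝟙 X ≫ _
        rw [Category.comp_id, Category.id_comp]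
      map_mul' := fun u v => by
        apply huniq (u * v) _ _ (Classical.choose_spec (hex (u * v)))
        have hu := Classical.choose_spec (hex u)
        have hv := Classical.choose_spec (hex v)
        change _ ≫ ((show Y ⟶ Y from (Classical.choose (hex v)).1) ≫
            (show Y ⟶ Y from (Classical.choose (hex u)).1)) =
          ((show X ⟶ X from v.1) ≫ (show X ⟶ X from u.1)) ≫ _
        rw [← Category.assoc, hv, Category.assoc, hu, Category.assoc] }
  have hg : ∀ u, Hom.mk (⟨⟨a, b, hab⟩, ρ⟩ : Rep X Y) ≫ (show Y ⟶ Y from (g u).1) =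
      (show X ⟶ X from u.1) ≫ Hom.mk (⟨⟨a, b, hab⟩, ρ⟩ : Rep X Y) :=
    fun u => Classical.choose_spec (hex u)
  have hbij : Function.Bijective g := by
    constructor
    · intro u v huv
      have h1 := hg u
      have h2 := hg v
      rw [huv] at h1
      apply Subtype.ext
      exact (cancel_mono (Hom.mk (⟨⟨a, b, hab⟩, ρ⟩ : Rep X Y) : X ⟶ Y)).mp (h1.symm.trans h2)
    · intro w
      obtain ⟨u, hu⟩ := hex' w
      exact ⟨u, huniq u _ _ (hg u) hu⟩
  exact ⟨MulEquiv.ofBijective g hbij, fun u => hg u⟩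

end Perfection

end PreFrobenioid

end Literature.AlgebraicGeometry.Frobenioids
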